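import Literature.Analysis.Calculus.SpherePolynomialEigenbasis
import Literature.Analysis.Calculus.SpherePolynomialDensity
import HarnessLib

/-!
# The sharp Poincaré inequality on round spheres: `λ₁(S^{n−1}) = n − 1`

Analysis file (everything proved; no definitions, no named facts): the first input of the `S³`
spectral block of A. Waldron, *Long-time existence for Yang–Mills flow*, Invent. math. 217
(2019), Lemma 3.5 ("the first eigenvalue of the Hodge Laplacian … on functions on `S³` is 3"),
obtained WITHOUT functional analysis by assembling: the finite-dimensional spectral shell
(`SphereSpectralShell`), the orthonormal eigenbases of the spherical Laplacian on homogeneous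
polynomials of degrees `N` and `N+1` with eigenvalues `k(k+n−2)` (`SpherePolynomialEigenbasis`,
`SphericalHarmonicEigen`, `HarmonicPolynomialLaplacian`), and Stone–Weierstrass density plus
homogenization (`SpherePolynomialDensity`).

* `eigenlam_eq_of_parity` — the eigenvalues on `HomL2 n K` are `k(k+n−2)` with `K − k` even;
  `eigenlam_ne_of_succ` — hence the degree-`K` and degree-`K+1` eigenvalues are distinct;
* `sphereIntegral_mul_eq_zero_of_eigen_ne` — eigenfunctions of the (symmetric) spherical
  Laplacian with distinct eigenvalues are `L²(S)`-orthogonal;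
* `sphereIntegral_sub_proj_sq_le` — the `L²(S)` projection onto an orthonormal family minimizes
  the distance;
* `sharp_poincare_sphere` — **for `n ≥ 2` and `f ∈ C²(ℝⁿ ∖ {0})`:
  `(n − 1) (∮_{S^{n−1}} f² − (∮ f)²/∮ 1) ≤ Q₁(f,f) = ½∑ᵢ∑ⱼ ∮ (∂_{L_{ij}} f)²`**
  (equality for linear functions), i.e. `∮ |∇_S f|² ≥ (n−1) ∮ (f − f̄)²`; on `S³`: `λ₁ = 3`.

References: A. Waldron, Invent. math. 217 (2019), Lemma 3.5 [Waldron2019]; (spherical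
harmonics) [folklore].
-/

noncomputable section

open scoped BigOperators RealInnerProductSpace
open MvPolynomial MeasureTheory Metric Set
open Literature.Analysis.FluidPDE

namespace Literature.Analysis.Calculus

namespace MvPoly

variable {n : ℕ}

local notation "𝔼" => EuclideanSpace ℝ (Fin n)
local notation "𝕓" => EuclideanSpace.basisFun (Fin n) ℝ

/-! ### Parity of the eigenvalues and distinctness across consecutive degrees -/

/-- The algebraic spectrum with parity: if `p ≠ 0` is homogeneous of degree `K` and
`ρ Δp = c₀ p` then `c₀ = K(K+n−2) − (K−2j)(K−2j+n−2)` for some `j` with `2j ≤ K`. [folklore] -/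
theorem eigenvalue_of_rho_lap_eq_smul_parity {p : MvPolynomial (Fin n) ℝ} {K : ℕ}
    (hp : p.IsHomogeneous K) (hp0 : p ≠ 0) {c₀ : ℝ} (h0 : rho * lap p = C c₀ * p) :
    ∃ j : ℕ, 2 * j ≤ K ∧
      c₀ = (K : ℝ) * (K + n - 2) - ((K - 2 * j : ℕ) : ℝ) * ((K - 2 * j : ℕ) + n - 2) := by
  classical
  have hfin : ∃ j, lap^[j] p ≠ 0 ∧ lap^[j + 1] p = 0 := by
    by_contra hcon
    simp only [not_exists, not_and] at hcon
    have hall : ∀ j, lap^[j] p ≠ 0 := by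
      intro j
      induction j with
      | zero => simpa using hp0
      | succ j ih => exact hcon j ih
    exact hall (K + 1) (lap_iterate_eq_zero hp (by omega))
  obtain ⟨j₀, hj₀, hj₁⟩ := hfin
  have h2j : 2 * j₀ ≤ K := by
    by_contra hlt
    exact hj₀ (lap_iterate_eq_zero hp (by omega))
  have hrec := rho_mul_lap_iterate hp h0 j₀ h2j
  rw [Function.iterate_succ_apply'] at hj₁
  rw [hj₁, mul_zero] at hrec
  have hc : c₀ - (2 * n * j₀ + 4 * K * j₀ - 4 * j₀ ^ 2 - 4 * j₀) = 0 := by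
    by_contra hne
    apply hj₀
    have := congrArg (fun q => C (c₀ - (2 * n * j₀ + 4 * K * j₀ - 4 * j₀ ^ 2 - 4 * j₀))⁻¹ * q) hrec
    simp only [mul_zero, ← mul_assoc, ← map_mul, inv_mul_cancel₀ hne, map_one, one_mul] at this
    exact this.symm
  refine ⟨j₀, h2j, ?_⟩
  rw [Nat.cast_sub h2j]
  push_cast
  linarith

/-- **Eigenvalues with parity**: on `HomL2 n K` every eigenvalue is `(K−2j)(K−2j+n−2)`.
[folklore] -/
theorem eigenlam_eq_of_parity [NeZero n] (hn : 2 ≤ n) {K : ℕ} (a : Fin (HomL2.dim n K)) :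
    ∃ j : ℕ, 2 * j ≤ K ∧
      HomL2.eigenlam (K := K) hn a = ((K - 2 * j : ℕ) : ℝ) * ((K - 2 * j : ℕ) + n - 2) := by
  set q := (HomL2.eigenbasis (K := K) hn a).val with hq
  have hqK : q.IsHomogeneous K := HomL2.isHomogeneous_val _
  have hq0 : q ≠ 0 := by
    intro h
    have h1 : HomL2.eigenbasis (K := K) hn a = 0 := HomL2.val_injective (by rw [← hq, h]; rfl)
    have h2 := (HomL2.eigenbasis (K := K) hn).orthonormal.1 a
    rw [h1, norm_zero] at h2
    exact zero_ne_one h2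
  set lam := HomL2.eigenlam (K := K) hn a with hlam
  set c₀ : ℝ := (K : ℝ) * (K + n - 2) - lam with hc₀
  have hw : (rho * lap q - C c₀ * q).IsHomogeneous K :=
    (isHomogeneous_rho_mul_lap hqK).sub (by simpa using (isHomogeneous_C _ c₀).mul hqK)
  have hw0 : rho * lap q - C c₀ * q = 0 := by
    refine eq_zero_of_isHomogeneous_of_forall_sphere (by omega) hw fun x _ => ?_
    have h1 := sphLaplacian_toFun_of_isHomogeneous hqK x
    have h2 := HomL2.sphLaplacian_eigenfun (K := K) hn a x
    simp only [HomL2.eigenfun] at h2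
    rw [← hq] at h2
    rw [h2] at h1
    rw [toFun_sub, toFun_mul, toFun_mul, toFun_C, hc₀]
    rw [toFun_mul] at h1
    linarith
  obtain ⟨j, hj, hcj⟩ := eigenvalue_of_rho_lap_eq_smul_parity hqK hq0 (sub_eq_zero.1 hw0)
  exact ⟨j, hj, by rw [hc₀] at hcj; linarith⟩

/-- `m ↦ m(m+n−2)` is strictly increasing on `ℕ` for `n ≥ 2`. [folklore] -/
theorem quadratic_strictMono (hn : 2 ≤ n) {m m' : ℕ} (h : m < m') :
    (m : ℝ) * (m + n - 2) < (m' : ℝ) * (m' + n - 2) := by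
  have h1 : (m : ℝ) + 1 ≤ m' := by exact_mod_cast h
  have hn' : (2 : ℝ) ≤ n := by exact_mod_cast hn
  have hm : (0 : ℝ) ≤ m := Nat.cast_nonneg _
  nlinarith

/-- **Consecutive degrees have disjoint spectra**: an eigenvalue on `HomL2 n K` never equals an
eigenvalue on `HomL2 n (K+1)` (their `k`'s have different parity). [folklore] -/
theorem eigenlam_ne_of_succ [NeZero n] (hn : 2 ≤ n) {K : ℕ} (a : Fin (HomL2.dim n K))
    (c : Fin (HomL2.dim n (K + 1))) :
    HomL2.eigenlam (K := K) hn a ≠ HomL2.eigenlam (K := K + 1) hn c := by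
  obtain ⟨j, hj, hja⟩ := eigenlam_eq_of_parity hn a
  obtain ⟨j', hj', hjc⟩ := eigenlam_eq_of_parity hn c
  rw [hja, hjc]
  intro heq
  -- `k = K - 2j` and `k' = K + 1 - 2j'` have different parity, so `k ≠ k'`
  have hne : K - 2 * j ≠ K + 1 - 2 * j' := by omega
  rcases lt_or_gt_of_ne hne with hlt | hgt
  · exact (quadratic_strictMono hn hlt).ne heq
  · exact (quadratic_strictMono hn hgt).ne heq.symm

/-! ### Orthogonality of eigenfunctions with distinct eigenvalues -/

section General

variable {E : Type*} [NormedAddCommGroup E] [InnerProductSpace ℝ E] [FiniteDimensional ℝ E]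
  [MeasurableSpace E] [BorelSpace E]
variable {ι : Type*} [Fintype ι]

/-- **Eigenfunctions of the spherical Laplacian with distinct eigenvalues are orthogonal** in
`L²(S_r)` (symmetry of `T`). [folklore] -/
theorem sphereIntegral_mul_eq_zero_of_eigen_ne [Nontrivial E] (b : OrthonormalBasis ι ℝ E)
    {e e' : E → ℝ} (he : ContDiffOn ℝ 2 e {0}ᶜ) (he' : ContDiffOn ℝ 2 e' {0}ᶜ) {r : ℝ} (hr : 0 < r)
    {lam lam' : ℝ} (hl : ∀ x, ‖x‖ = r → sphLaplacian b e x = -lam * e x)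
    (hl' : ∀ x, ‖x‖ = r → sphLaplacian b e' x = -lam' * e' x) (hne : lam ≠ lam') :
    sphereIntegral (volume : Measure E) (fun x => e x * e' x) r = 0 := by
  have h1 := sphDirichlet_eq_neg_sphereIntegral b (he.of_le (by norm_num)) he' hr
  have h2 := sphDirichlet_eq_neg_sphereIntegral b (he'.of_le (by norm_num)) he hr
  rw [sphDirichlet_comm] at h2
  rw [sphereIntegral_congr_norm hr.le (g := fun x => (-lam') * (e x * e' x))
    (fun x hx => by rw [hl' x hx]; ring), sphereIntegral_mul_left] at h1
  rw [sphereIntegral_congr_norm hr.le (g := fun x => (-lam) * (e x * e' x))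
    (fun x hx => by rw [hl x hx]; ring), sphereIntegral_mul_left] at h2
  have h3 : (lam - lam') * sphereIntegral (volume : Measure E) (fun x => e x * e' x) r = 0 := by
    linarith
  rcases mul_eq_zero.1 h3 with h | h
  · exact absurd (sub_eq_zero.1 h) hne
  · exact h

/-- Comparison of sphere integrals from a pointwise bound on the sphere. [folklore] -/
theorem sphereIntegral_mono_of_norm {g h : E → ℝ} (hg : ContinuousOn g {0}ᶜ)
    (hh : ContinuousOn h {0}ᶜ) {r : ℝ} (hr : 0 < r) (hle : ∀ x, ‖x‖ = r → g x ≤ h x) :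
    sphereIntegral (volume : Measure E) g r ≤ sphereIntegral (volume : Measure E) h r := by
  rw [sphereIntegral_def, sphereIntegral_def]
  exact integral_mono (integrable_toSphere_of_continuousOn hg hr)
    (integrable_toSphere_of_continuousOn hh hr) fun θ => hle _ (norm_smul_sphere hr.le θ)

/-- **The `L²(S_r)` projection onto an orthonormal family minimizes the distance**: with
`cₖ = ∮ f eₖ`, `∮ (f − ∑ cₖeₖ)² ≤ ∮ (f − ∑ dₖeₖ)²` for all coefficients `d`. [folklore] -/
theorem sphereIntegral_sub_proj_sq_le {M : ℕ} {e : Fin M → E → ℝ}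
    (hec : ∀ k, ContinuousOn (e k) {0}ᶜ) {r : ℝ} (hr : 0 < r)
    (hon : ∀ k l, sphereIntegral (volume : Measure E) (fun x => e k x * e l x) r =
      if k = l then 1 else 0)
    {f : E → ℝ} (hf : ContinuousOn f {0}ᶜ) (d : Fin M → ℝ) :
    sphereIntegral (volume : Measure E)
        (fun x => (f x - ∑ k, sphereIntegral (volume : Measure E) (fun y => f y * e k y) r * e k x) ^ 2) r
      ≤ sphereIntegral (volume : Measure E) (fun x => (f x - ∑ k, d k * e k x) ^ 2) r := by
  set c : Fin M → ℝ := fun k => sphereIntegral (volume : Measure E) (fun y => f y * e k y) r with hc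
  set g : E → ℝ := fun x => f x - ∑ k, c k * e k x with hg
  have hπc : ContinuousOn (fun x => ∑ k, c k * e k x) {0}ᶜ :=
    continuousOn_finsetSum _ fun k _ => continuousOn_const.mul (hec k)
  have hgc : ContinuousOn g {0}ᶜ := hf.sub hπc
  -- orthogonality of the remainder
  have horth : ∀ k, sphereIntegral (volume : Measure E) (fun x => g x * e k x) r = 0 := by
    intro k
    have h1 : (fun x => g x * e k x) = fun x => f x * e k x - (∑ l, c l * e l x) * e k x := by
      funext x; simp only [hg]; ring
    have h2 : sphereIntegral (volume : Measure E) (fun x => (∑ l, c l * e l x) * e k x) r = c k := by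
      rw [show (fun x => (∑ l, c l * e l x) * e k x) = fun x => e k x * ∑ l, c l * e l x from
        funext fun x => mul_comm _ _, sphereIntegral_mul_sum hec (hec k) hr]
      simp_rw [hon, mul_ite, mul_one, mul_zero]
      simp
    rw [h1, sphereIntegral_sub_of (fun x => f x * e k x) (fun x => (∑ l, c l * e l x) * e k x)
      (hf.mul (hec k)) (hπc.mul (hec k)) hr, h2]
    simp [hc]
  -- expand `f - ∑ d e = g + ∑ (c - d) e`
  have hdec : ∀ x, f x - ∑ k, d k * e k x = g x + ∑ k, (c k - d k) * e k x := by
    intro x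
    simp only [hg, sub_mul, Finset.sum_sub_distrib]
    ring
  have hwc : ContinuousOn (fun x => ∑ k, (c k - d k) * e k x) {0}ᶜ :=
    continuousOn_finsetSum _ fun k _ => continuousOn_const.mul (hec k)
  have hexp : (fun x => (f x - ∑ k, d k * e k x) ^ 2) =
      fun x => (g x ^ 2 + 2 * (g x * ∑ k, (c k - d k) * e k x)) +
        (∑ k, (c k - d k) * e k x) * (∑ k, (c k - d k) * e k x) := by
    funext x; rw [hdec x]; ring
  have hcross : sphereIntegral (volume : Measure E) (fun x => g x * ∑ k, (c k - d k) * e k x) r = 0 := by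
    rw [sphereIntegral_mul_sum hec hgc hr]
    simp [horth]
  rw [hexp, sphereIntegral_add_of (fun x => g x ^ 2 + 2 * (g x * ∑ k, (c k - d k) * e k x))
      (fun x => (∑ k, (c k - d k) * e k x) * ∑ k, (c k - d k) * e k x)
      ((hgc.pow 2).add (continuousOn_const.mul (hgc.mul hwc))) (hwc.mul hwc) hr,
    sphereIntegral_add_of (fun x => g x ^ 2) (fun x => 2 * (g x * ∑ k, (c k - d k) * e k x))
      (hgc.pow 2) (continuousOn_const.mul (hgc.mul hwc)) hr,
    sphereIntegral_mul_left, hcross, mul_zero, add_zero, sphereIntegral_sum_mul_sum hec hr hon]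
  have : 0 ≤ ∑ k, (c k - d k) * (c k - d k) := Finset.sum_nonneg fun k _ => mul_self_nonneg _
  simp only [hg] at this ⊢
  linarith

end General

/-! ### The sharp Poincaré inequality -/

/-- A small real-analysis helper: `a ≤ b` if `a ≤ b + ε` for all `ε > 0` — Mathlib's
`le_of_forall_pos_le_add`; kept as a deprecated alias (librarian dedup-02024). [folklore] -/
@[deprecated le_of_forall_pos_le_add (since := "2026-08-16")]
alias le_of_forall_pos_le_add' := le_of_forall_pos_le_add

set_option maxHeartbeats 800000 in
/-- **The sharp Poincaré inequality on `S^{n−1}`** (`n ≥ 2`): for `f ∈ C²(ℝⁿ ∖ {0})`,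
`(n − 1)(∮ f² − (∮ f)²/∮ 1) ≤ Q₁(f, f) = ½∑ᵢ∑ⱼ ∮ (∂_{L_{ij}} f)²`, i.e.
`∮_{S^{n−1}} |∇_S f|² ≥ (n − 1) ∮ (f − f̄)²`; the constant is the first nonzero eigenvalue
`n − 1` of the spherical Laplacian (attained by linear functions), `= 3` on `S³`.
[cite: Waldron2019, Lemma 3.5 ("the first eigenvalue … on functions is 3")] -/
theorem sharp_poincare_sphere (hn : 2 ≤ n) {f : 𝔼 → ℝ} (hf : ContDiffOn ℝ 2 f {0}ᶜ) :
    ((n : ℝ) - 1) * (sphereIntegral (volume : Measure 𝔼) (fun x => f x ^ 2) 1 -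
        (sphereIntegral (volume : Measure 𝔼) f 1) ^ 2 /
          sphereIntegral (volume : Measure 𝔼) (fun _ => (1 : ℝ)) 1) ≤
      sphDirichlet 𝕓 f f 1 := by
  classical
  haveI : NeZero n := ⟨by omega⟩
  haveI : Nontrivial 𝔼 := by
    haveI : Nonempty (Fin n) := ⟨⟨0, by omega⟩⟩
    infer_instance
  set σ := sphereIntegral (volume : Measure 𝔼) (fun _ => (1 : ℝ)) 1 with hσ
  have hσpos : 0 < σ := sphereIntegral_one_pos 1
  have hn1 : (0 : ℝ) ≤ (n : ℝ) - 1 := by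
    have : (2 : ℝ) ≤ n := by exact_mod_cast hn
    linarith
  have hfc : ContinuousOn f {0}ᶜ := hf.continuousOn
  -- it suffices to prove the bound up to `(n-1) δ` for every `δ > 0`
  refine le_of_forall_pos_le_add fun η hη => ?_
  -- choose `δ` with `(n-1) δ ≤ η` and `ε` with `ε² σ ≤ δ`
  set δ : ℝ := η / ((n : ℝ) - 1 + 1) with hδ
  have hδpos : 0 < δ := div_pos hη (by linarith)
  have hδη : ((n : ℝ) - 1) * δ ≤ η := by
    rw [hδ, mul_div_assoc']
    rw [div_le_iff₀ (by linarith)]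
    nlinarith
  set ε : ℝ := min 1 (δ / σ) with hε
  have hεpos : 0 < ε := lt_min one_pos (div_pos hδpos hσpos)
  have hε1 : ε ≤ 1 := min_le_left _ _
  have hεδ : ε ^ 2 * σ ≤ δ := by
    have h1 : ε ≤ δ / σ := min_le_right _ _
    calc ε ^ 2 * σ = ε * (ε * σ) := by ring
      _ ≤ 1 * (δ / σ * σ) := by
          apply mul_le_mul hε1 _ (by positivity) zero_le_one
          exact mul_le_mul_of_nonneg_right h1 hσpos.le
      _ = δ := by field_simp
  -- ### Stone–Weierstrass and homogenization
  obtain ⟨P, hP⟩ := exists_poly_near_of_continuousOn hfc hεpos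
  obtain ⟨q₁, q₂, hq₁, hq₂, hPq⟩ := exists_homogenization P
  set N := P.totalDegree with hN
  -- ### the two eigenfamilies and their concatenation
  set d₁ := HomL2.dim n N with hd₁
  set d₂ := HomL2.dim n (N + 1) with hd₂
  set e₁ : Fin d₁ → 𝔼 → ℝ := HomL2.eigenfun (K := N) hn with he₁
  set e₂ : Fin d₂ → 𝔼 → ℝ := HomL2.eigenfun (K := N + 1) hn with he₂
  set l₁ : Fin d₁ → ℝ := HomL2.eigenlam (K := N) hn with hl₁
  set l₂ : Fin d₂ → ℝ := HomL2.eigenlam (K := N + 1) hn with hl₂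
  set e : Fin (d₁ + d₂) → 𝔼 → ℝ := Fin.append e₁ e₂ with hedef
  set lam : Fin (d₁ + d₂) → ℝ := Fin.append l₁ l₂ with hlamdef
  have he2 : ∀ k, ContDiffOn ℝ 2 (e k) {0}ᶜ := by
    intro k
    refine Fin.addCases (fun i => ?_) (fun j => ?_) k
    · rw [hedef, Fin.append_left]; exact (HomL2.contDiff_eigenfun hn i).contDiffOn
    · rw [hedef, Fin.append_right]; exact (HomL2.contDiff_eigenfun hn j).contDiffOn
  have hec : ∀ k, ContinuousOn (e k) {0}ᶜ := fun k => (he2 k).continuousOn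
  have heig : ∀ k x, ‖x‖ = (1 : ℝ) → sphLaplacian 𝕓 (e k) x = -lam k * e k x := by
    intro k x _
    refine Fin.addCases (fun i => ?_) (fun j => ?_) k
    · rw [hedef, hlamdef, Fin.append_left, Fin.append_left]
      exact HomL2.sphLaplacian_eigenfun hn i x
    · rw [hedef, hlamdef, Fin.append_right, Fin.append_right]
      exact HomL2.sphLaplacian_eigenfun hn j x
  have hgap : ∀ k, lam k = 0 ∨ (n : ℝ) - 1 ≤ lam k := by
    intro k
    refine Fin.addCases (fun i => ?_) (fun j => ?_) k
    · rw [hlamdef, Fin.append_left]; exact HomL2.eigenlam_zero_or_ge hn i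
    · rw [hlamdef, Fin.append_right]; exact HomL2.eigenlam_zero_or_ge hn j
  have hconst : ∀ k, lam k = 0 → ∀ x y : 𝔼, ‖x‖ = 1 → ‖y‖ = 1 → e k x = e k y := by
    intro k
    refine Fin.addCases (fun i => ?_) (fun j => ?_) k
    · rw [hlamdef, hedef, Fin.append_left, Fin.append_left]
      exact fun h0 x y hx hy => HomL2.eigenfun_const_of_eigenlam_eq_zero hn i h0 hx hy
    · rw [hlamdef, hedef, Fin.append_right, Fin.append_right]
      exact fun h0 x y hx hy => HomL2.eigenfun_const_of_eigenlam_eq_zero hn j h0 hx hy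
  have heig₁ : ∀ i x, ‖x‖ = (1 : ℝ) → sphLaplacian 𝕓 (e₁ i) x = -l₁ i * e₁ i x :=
    fun i x _ => HomL2.sphLaplacian_eigenfun hn i x
  have heig₂ : ∀ j x, ‖x‖ = (1 : ℝ) → sphLaplacian 𝕓 (e₂ j) x = -l₂ j * e₂ j x :=
    fun j x _ => HomL2.sphLaplacian_eigenfun hn j x
  have hE₁ : ∀ i, ContDiffOn ℝ 2 (e₁ i) {0}ᶜ := fun i => (HomL2.contDiff_eigenfun hn i).contDiffOn
  have hE₂ : ∀ j, ContDiffOn ℝ 2 (e₂ j) {0}ᶜ := fun j => (HomL2.contDiff_eigenfun hn j).contDiffOn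
  have hcross : ∀ i j, sphereIntegral (volume : Measure 𝔼) (fun x => e₁ i x * e₂ j x) 1 = 0 :=
    fun i j => sphereIntegral_mul_eq_zero_of_eigen_ne 𝕓 (hE₁ i) (hE₂ j) one_pos (heig₁ i) (heig₂ j)
      (eigenlam_ne_of_succ hn i j)
  have hon : ∀ k l, sphereIntegral (volume : Measure 𝔼) (fun x => e k x * e l x) 1 =
      if k = l then 1 else 0 := by
    intro k l
    refine Fin.addCases (fun i => ?_) (fun j => ?_) k <;>
      refine Fin.addCases (fun i' => ?_) (fun j' => ?_) l
    · rw [hedef, Fin.append_left, Fin.append_left, HomL2.sphereIntegral_eigenfun_mul hn i i']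
      by_cases h : i = i'
      · subst h; simp
      · have : (Fin.castAdd d₂ i : Fin (d₁ + d₂)) ≠ Fin.castAdd d₂ i' := fun h' =>
          h (Fin.castAdd_injective _ _ h')
        simp [h, this]
    · rw [hedef, Fin.append_left, Fin.append_right]
      have hne : (Fin.castAdd d₂ i : Fin (d₁ + d₂)) ≠ Fin.natAdd d₁ j' := by
        intro h; have := congrArg Fin.val h; simp at this; omega
      rw [if_neg hne]
      exact hcross i j'
    · rw [hedef, Fin.append_right, Fin.append_left]
      have hne : (Fin.natAdd d₁ j : Fin (d₁ + d₂)) ≠ Fin.castAdd d₂ i' := by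
        intro h; have := congrArg Fin.val h; simp at this; omega
      rw [if_neg hne, show (fun x => e₂ j x * e₁ i' x) = fun x => e₁ i' x * e₂ j x from
        funext fun x => mul_comm _ _]
      exact hcross i' j
    · rw [hedef, Fin.append_right, Fin.append_right, HomL2.sphereIntegral_eigenfun_mul hn j j']
      by_cases h : j = j'
      · subst h; simp
      · have : (Fin.natAdd d₁ j : Fin (d₁ + d₂)) ≠ Fin.natAdd d₁ j' := fun h' =>
          h (Fin.natAdd_injective _ _ h')
        simp [h, this]
  -- ### the shell estimate
  have H := sphDirichlet_ge_of_eigenfamily 𝕓 one_pos he2 hon heig hn1 hgap hconst hf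
  -- ### the projection error is at most `δ`
  obtain ⟨c₁, hc₁⟩ := HomL2.exists_eq_sum_eigenfun hn (HomL2.mk q₁ hq₁)
  obtain ⟨c₂, hc₂⟩ := HomL2.exists_eq_sum_eigenfun hn (HomL2.mk q₂ hq₂)
  simp only [HomL2.val_mk] at hc₁ hc₂
  set dcoef : Fin (d₁ + d₂) → ℝ := Fin.append c₁ c₂ with hdcoef
  have hspan : ∀ x, ∑ k, dcoef k * e k x = toFun q₁ x + toFun q₂ x := by
    intro x
    rw [Fin.sum_univ_add, hc₁ x, hc₂ x]
    simp only [hdcoef, hedef, Fin.append_left, Fin.append_right]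
    rfl
  have hmin := sphereIntegral_sub_proj_sq_le hec one_pos hon hfc dcoef
  have hbound : sphereIntegral (volume : Measure 𝔼) (fun x => (f x - ∑ k, dcoef k * e k x) ^ 2) 1 ≤ δ := by
    have hwc : ContinuousOn (fun x => ∑ k, dcoef k * e k x) {0}ᶜ :=
      continuousOn_finsetSum _ fun k _ => continuousOn_const.mul (hec k)
    calc sphereIntegral (volume : Measure 𝔼) (fun x => (f x - ∑ k, dcoef k * e k x) ^ 2) 1
        ≤ sphereIntegral (volume : Measure 𝔼) (fun _ => ε ^ 2) 1 := by
          refine sphereIntegral_mono_of_norm (g := fun x => (f x - ∑ k, dcoef k * e k x) ^ 2)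
            (h := fun _ => ε ^ 2) ((hfc.sub hwc).pow 2) continuousOn_const one_pos fun x hx => ?_
          rw [hspan x, ← hPq x hx]
          have h1 := hP x hx
          rw [abs_lt] at h1
          nlinarith [h1.1, h1.2]
      _ = ε ^ 2 * σ := by rw [← sphereIntegral_mul_left]; simp
      _ ≤ δ := hεδ
  -- ### conclude
  have hfinal : ((n : ℝ) - 1) * (sphereIntegral (volume : Measure 𝔼) (fun x => f x ^ 2) 1 - δ -
      (sphereIntegral (volume : Measure 𝔼) f 1) ^ 2 / σ) ≤ sphDirichlet 𝕓 f f 1 := by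
    refine le_trans (mul_le_mul_of_nonneg_left ?_ hn1) H
    linarith [hmin, hbound]
  nlinarith [hfinal, hδη]

end MvPoly



end Literature.Analysis.Calculus
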